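import Literature.NumberTheory.ModularSymbols.FullLevelHomologyTwistCycle
import Literature.NumberTheory.ModularSymbols.CuspidalHomologyTwistOperator
import Literature.NumberTheory.ModularSymbols.FullLevelHomologySpreadLattice
import Literature.NumberTheory.ModularSymbols.FullLevelHomologyHeckeComparison
import HarnessLib

/-!
# The up/down dictionary intertwines the twisting operators: `M_θ T_θ^{up}` on `H₁(Γ₀(M), k[GL₂(ℤ/p)])^{T̃}`
# ↔ `T_χ = Σ_u χ(u)[1 u/p; 0 1]_*` on `H₁(X₀(p²M), k)`

Topic `Literature/NumberTheory/ModularSymbols`; namespace `Literature.NumberTheory.ModularSymbols.FullLevel`; sequel of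
`FullLevelHomologyTwistCycle` (upstairs: `twistInvariants (cosetClass [γ ⊗ aδ_{T̃}]) = θ(−1)·cosetClass(Σ_w [γ] ⊗ θ(w)aδ_{u(w)T̃})`),
`FullLevelHomologyCosetTransferFormula` (dictionary on a family, any section) and `CuspidalHomologyTwistOperator` (`twistDownK`,
`twistDownK_symbol_eq_sum`, `periodClassK_twistDownK`).  The twisting analogue of `FullLevelHomologyHeckeComparison`.
Definitions with bodies + proved theorems; no named fact, no `sorry`, no instance, no notation.

With the section `u(w)T̃ ↦ T^{w̃} = (1 w̃; 0 1) ∈ Γ₀(M)` (`twistSection`; `w̃ = w.val`) the transfer elements of the twisted family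
are `t_w = T^{−w̃} γ T^{w̃'}`, and `δ⁻¹ t_w δ ∈ Γ₀(p²M)` has entries `(a − w̃c, ∗; pc, ∗)`, i.e. cusp `γ'∞ − w̃/p`
(`γ' = δ⁻¹γδ = (a, b/p; pc, d)`); so by `twistDownK_symbol_eq_sum` (the tree's twisting formula
`g(χ){∞,γ'∞}_{h_χ} = Σ_u χ(u){∞, γ'∞ + u/p}_h` for EVERY cusp form `h`, with the matrices `X_u := δ⁻¹ t_{−u} δ`):

* `Tpow`, `redGL_Tpow`, `twistSection`, `twistSection_unipCoset`, `twistSection_smul`; `entry_transfer_*` (entries of `t_w`);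
* **`twistComparison_baseCycle`**, **`twistComparison`**: for every `y ∈ H₁(Γ₀(M), k[GL₂(ℤ/p)])^{T̃}`,
  `torusInvariantsToCuspidal (twistInvariants θ hθ y) = twistDownK (p²M) _ hχ hprim k (torusInvariantsToCuspidal y)`,
  under the dictionary hypothesis `hθχ : θ(w) = χ(w)` in `k` (`MulChar.ofUnitHom θ w = quadInt χ w`, all `w`);
* **`torusPeriodClass_twistInvariants`**: `torusPeriodClass f (twistInvariants θ hθ y) = (1 ⊗ g(χ)·)(torusPeriodClass f_χ y)` in
  `k ⊗ Λ_f` — the transfer identity behind the datum field (D5) `βW(g·w) = T_χ(βV w)` of the K-line of route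
  BSD/TeichmullerTwistDescent (crux `TwistedPeriodLatticeSaturation`), now a tree theorem about the carrier.

## References
* B. Mazur, J. Tate, J. Teitelbaum, Invent. Math. 84 (1986), §I.8. [MazurTateTeitelbaum1986]
* G. Stevens, Invent. Math. 98 (1989), Lemma (5.4), (5.5) p. 97. [Stevens1989]
* G. Shimura, *Introduction to the arithmetic theory of automorphic functions* (1971), Prop. 3.64. [Shimura1971]
* A. Ash, G. Stevens, Duke Math. J. 53 (1986), §1 (1.2)–(1.4). [AshStevens1986]
* F. Diamond, J. Shurman, *A First Course in Modular Forms* (2005), §1.2, §1.5. [DiamondShurman2005]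
-/

noncomputable section

namespace Literature.NumberTheory.ModularSymbols

namespace FullLevel

open scoped MatrixGroups TensorProduct
open CategoryTheory CongruenceSubgroup groupHomology Finsupp Matrix
open Literature.Algebra.Homology
open Literature.NumberTheory.EllipticCurves.ModularForms
open Literature.RepresentationTheory.FiniteGroups

variable (p M : ℕ) [Fact p.Prime]

/-! ### The section `u(w)T̃ ↦ T^{w̃}` and its transfer elements -/

/-- `T^n = (1 n; 0 1) ∈ Γ₀(M)`. [cite: DiamondShurman2005, §1.2] -/
def Tpow (n : ℤ) : Gamma0 M :=
  ⟨ModularGroup.T ^ n, by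
    rw [Gamma0_mem]
    have h : (ModularGroup.T ^ n) 1 0 = 0 := by
      show (ModularGroup.T ^ n).1 1 0 = 0
      rw [ModularGroup.coe_T_zpow]; rfl
    rw [h, Int.cast_zero]⟩

/-- Entries of `T^n`. [cite: DiamondShurman2005, §1.2] -/
theorem coe_Tpow (n : ℤ) : (((Tpow M n : Gamma0 M) : SL(2, ℤ)) : Matrix (Fin 2) (Fin 2) ℤ) = !![1, n; 0, 1] :=
  ModularGroup.coe_T_zpow n

/-- `T^m T^n = T^{m+n}`. [cite: DiamondShurman2005, §1.2] -/
theorem Tpow_add (m n : ℤ) : Tpow M (m + n) = Tpow M m * Tpow M n := by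
  apply Subtype.ext
  show ModularGroup.T ^ (m + n) = ModularGroup.T ^ m * ModularGroup.T ^ n
  exact zpow_add _ m n

/-- `(T^n)⁻¹ = T^{−n}`. [cite: DiamondShurman2005, §1.2] -/
theorem Tpow_neg (n : ℤ) : Tpow M (-n) = (Tpow M n)⁻¹ := by
  apply Subtype.ext
  show ModularGroup.T ^ (-n) = (ModularGroup.T ^ n)⁻¹
  exact zpow_neg _ n

/-- `T^n mod p = u(n)`. [cite: DiamondShurman2005, §1.2] -/
theorem redGL_Tpow (n : ℤ) : redGL p M (Tpow M n) = GL2.upperUnip (ZMod p) (n : ZMod p) := by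
  refine Matrix.GeneralLinearGroup.ext fun i j => ?_
  rw [redGL_apply_coe, coe_Tpow, GL2.coe_upperUnip]
  fin_cases i <;> fin_cases j <;> simp

variable (hpM : Nat.Coprime p M)

open Classical in
/-- **The section** `GL₂(ℤ/p)/T̃ → Γ₀(M)` which is `T^{w̃}` on the cosets `u(w)T̃` (`w̃ = w.val`) and the generic section `sec`
elsewhere. [cite: Brown1982, Ch. III §9 (A)] -/
def twistSection (y : GL (Fin 2) (ZMod p) ⧸ diagTorus (ZMod p)) : Gamma0 M :=
  if h : ∃ w : ZMod p, unipCoset p w = y then Tpow M ((Classical.choose h).val : ℤ) else sec p M hpM y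

/-- `twistSection (u(w)T̃) = T^{w̃}`. [cite: Brown1982, Ch. III §9 (A)] -/
theorem twistSection_unipCoset (w : ZMod p) : twistSection p M hpM (unipCoset p w) = Tpow M (w.val : ℤ) := by
  have h : ∃ w' : ZMod p, unipCoset p w' = unipCoset p w := ⟨w, rfl⟩
  rw [twistSection, dif_pos h, unipCoset_injective p (Classical.choose_spec h)]

/-- `twistSection` is a section: `s(y)·T̃ = y`. [cite: Brown1982, Ch. III §9 (A)] -/
theorem twistSection_smul (y : GL (Fin 2) (ZMod p) ⧸ diagTorus (ZMod p)) :
    redGL p M (twistSection p M hpM y) • baseCoset p = y := by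
  by_cases h : ∃ w : ZMod p, unipCoset p w = y
  · obtain ⟨w, rfl⟩ := h
    rw [twistSection_unipCoset, redGL_Tpow, Int.cast_natCast, ZMod.natCast_zmod_val, upperUnip_smul_baseCoset]
  · rw [twistSection, dif_neg h, sec_smul]

/-- Entries of `T^{−m} g T^{n}`: lower-left `c`, upper-left `a − m c`. [cite: DiamondShurman2005, §1.2] -/
theorem entry_Tpow_inv_mul_mul_Tpow (g : Gamma0 M) (m n : ℤ) :
    ((((Tpow M m)⁻¹ * g * Tpow M n : Gamma0 M) : SL(2, ℤ)) : Matrix (Fin 2) (Fin 2) ℤ) 1 0 =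
        ((g : SL(2, ℤ)) : Matrix (Fin 2) (Fin 2) ℤ) 1 0 ∧
      ((((Tpow M m)⁻¹ * g * Tpow M n : Gamma0 M) : SL(2, ℤ)) : Matrix (Fin 2) (Fin 2) ℤ) 0 0 =
        ((g : SL(2, ℤ)) : Matrix (Fin 2) (Fin 2) ℤ) 0 0 - m * ((g : SL(2, ℤ)) : Matrix (Fin 2) (Fin 2) ℤ) 1 0 := by
  rw [← Tpow_neg]
  have e : ((((Tpow M (-m)) * g * Tpow M n : Gamma0 M) : SL(2, ℤ)) : Matrix (Fin 2) (Fin 2) ℤ) =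
      !![1, -m; 0, 1] * ((g : SL(2, ℤ)) : Matrix (Fin 2) (Fin 2) ℤ) * !![1, n; 0, 1] := by
    rw [Subgroup.coe_mul, Subgroup.coe_mul, Matrix.SpecialLinearGroup.coe_mul, Matrix.SpecialLinearGroup.coe_mul,
      coe_Tpow, coe_Tpow]
  rw [e, Matrix.eta_fin_two ((g : SL(2, ℤ)) : Matrix (Fin 2) (Fin 2) ℤ), Matrix.mul_fin_two, Matrix.mul_fin_two]
  constructor
  · simp
  · simp; ring

/-- The transfer elements `t_w ∈ Γ_T` of the twisted family for the section `twistSection`. [cite: Brown1982, Ch. III §9 (A)] -/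
def twistTransfer (γ : torusLevel p M) (w : ZMod p) : torusLevel p M :=
  transferFamily p M (twistSection p M hpM) (twistSection_smul p M hpM) (fun _ : ZMod p => γ.1) (unipCoset p) w

/-- **`t_w = T^{−w̃} γ T^{w̃'}`** with `u(w')T̃ = γ̄⁻¹·u(w)T̃`. [cite: Brown1982, Ch. III §9 (A)] -/
theorem exists_twistTransfer_eq (γ : torusLevel p M) (w : ZMod p) :
    ∃ w' : ZMod p, (twistTransfer p M hpM γ w : Gamma0 M) = (Tpow M (w.val : ℤ))⁻¹ * γ.1 * Tpow M (w'.val : ℤ) := by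
  obtain ⟨c₁, c₂, hc⟩ := exists_diagElt_eq p (inv_mem (redGL_mem_diagTorus_of_mem_torusLevel p M γ.2))
  refine ⟨(c₁ : ZMod p) * w / c₂, ?_⟩
  rw [twistTransfer, coe_transferFamily, ← hc, diagElt_smul_unipCoset, twistSection_unipCoset, twistSection_unipCoset]

/-- Entries of `t_w`: lower-left `c`, upper-left `a − w̃ c` (`γ = (a b; c d)`). [cite: DiamondShurman2005, §1.5] -/
theorem entry_twistTransfer (γ : torusLevel p M) (w : ZMod p) :
    ((((twistTransfer p M hpM γ w : Gamma0 M)) : SL(2, ℤ)) : Matrix (Fin 2) (Fin 2) ℤ) 1 0 =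
        ((γ.1 : SL(2, ℤ)) : Matrix (Fin 2) (Fin 2) ℤ) 1 0 ∧
      ((((twistTransfer p M hpM γ w : Gamma0 M)) : SL(2, ℤ)) : Matrix (Fin 2) (Fin 2) ℤ) 0 0 =
        ((γ.1 : SL(2, ℤ)) : Matrix (Fin 2) (Fin 2) ℤ) 0 0 - (w.val : ℤ) * ((γ.1 : SL(2, ℤ)) : Matrix (Fin 2) (Fin 2) ℤ) 1 0 := by
  obtain ⟨w', hw'⟩ := exists_twistTransfer_eq p M hpM γ w
  rw [hw']
  exact entry_Tpow_inv_mul_mul_Tpow M γ.1 _ _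

/-- Entries of `δ⁻¹ t_w δ ∈ Γ₀(p²M)`: lower-left `pc`, upper-left `a − w̃ c`. [cite: DiamondShurman2005, §1.5] -/
theorem entry_torusLevelEquiv_twistTransfer (γ : torusLevel p M) (w : ZMod p) :
    (((torusLevelEquiv p M hpM (twistTransfer p M hpM γ w) : Gamma0 (p ^ 2 * M)) : SL(2, ℤ)) : Matrix (Fin 2) (Fin 2) ℤ) 1 0 =
        ((γ.1 : SL(2, ℤ)) : Matrix (Fin 2) (Fin 2) ℤ) 1 0 * p ∧
      (((torusLevelEquiv p M hpM (twistTransfer p M hpM γ w) : Gamma0 (p ^ 2 * M)) : SL(2, ℤ)) : Matrix (Fin 2) (Fin 2) ℤ) 0 0 =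
        ((γ.1 : SL(2, ℤ)) : Matrix (Fin 2) (Fin 2) ℤ) 0 0 - (w.val : ℤ) * ((γ.1 : SL(2, ℤ)) : Matrix (Fin 2) (Fin 2) ℤ) 1 0 := by
  obtain ⟨h10, h00⟩ := entry_twistTransfer p M hpM γ w
  rw [coe_torusLevelEquiv, conjDown]
  simp only [Matrix.of_apply, Matrix.cons_val', Matrix.cons_val_zero, Matrix.cons_val_one, Matrix.cons_val_fin_one]
  exact ⟨by rw [h10], h00⟩

/-- Entries of `γ' = δ⁻¹ γ δ`: lower-left `pc`, upper-left `a`. [cite: DiamondShurman2005, §1.5] -/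
theorem entry_torusLevelEquiv (γ : torusLevel p M) :
    (((torusLevelEquiv p M hpM γ : Gamma0 (p ^ 2 * M)) : SL(2, ℤ)) : Matrix (Fin 2) (Fin 2) ℤ) 1 0 =
        ((γ.1 : SL(2, ℤ)) : Matrix (Fin 2) (Fin 2) ℤ) 1 0 * p ∧
      (((torusLevelEquiv p M hpM γ : Gamma0 (p ^ 2 * M)) : SL(2, ℤ)) : Matrix (Fin 2) (Fin 2) ℤ) 0 0 =
        ((γ.1 : SL(2, ℤ)) : Matrix (Fin 2) (Fin 2) ℤ) 0 0 := by
  rw [coe_torusLevelEquiv, conjDown]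
  simp

/-- `−w̃/p ≡ (−w)~/p (mod ℤ)`: `−(w.val)/p = twistShift(−w) + n` with `n ∈ {0, −1}`. [cite: Stevens1989, (5.5) p. 97] -/
theorem exists_neg_val_div_eq_twistShift_neg (w : ZMod p) : ∃ n : ℤ, -((w.val : ℚ) / p) = twistShift (-w) + n := by
  by_cases hw : w = 0
  · refine ⟨0, ?_⟩
    rw [hw, neg_zero, twistShift, ZMod.val_zero]
    simp
  · refine ⟨-1, ?_⟩
    have hp : (p : ℚ) ≠ 0 := by exact_mod_cast (Fact.out : p.Prime).ne_zero
    have hle : w.val ≤ p := (ZMod.val_lt w).le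
    rw [twistShift, ZMod.neg_val, if_neg hw, Nat.cast_sub hle]
    field_simp
    ring

/-! ### The comparison on base coset classes -/

variable (k : Type) [CommRing k] [Fintype (diagTorus (ZMod p))] [Invertible (Fintype.card (diagTorus (ZMod p)) : k)]
variable (θ : (ZMod p)ˣ →* kˣ) (hθ : ∀ u, θ u * θ u = 1)
variable [NeZero M] [NeZero (p ^ 2 * M)]
variable {χ : DirichletCharacter ℂ p} (hχ : χ.IsQuadratic) (hprim : χ.IsPrimitive)
  (hθχ : ∀ w : ZMod p, MulChar.ofUnitHom θ w = (quadInt χ w : k))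

/-- The modular symbol of a matrix with `c = 0` vanishes. [cite: Manin1972, Prop. 1.4] -/
theorem symbol_eq_zero_of_entry_eq_zero {N : ℕ} [NeZero N] (X : Gamma0 N) (hX : (X : SL(2, ℤ)) 1 0 = 0) :
    Literature.NumberTheory.ModularSymbols.symbol N k X = 0 := by
  have h : symbolInt N X = 0 := by
    apply Subtype.ext
    refine LinearMap.ext fun h => ?_
    rw [symbolInt_apply, cuspSymbol, if_pos hX]
    rfl
  rw [symbol_def, h, TensorProduct.tmul_zero]

include hθ in
/-- **The dictionary on the twisted family class**:
`torusInvariantsToCuspidal (cosetClass(Σ_w [γ] ⊗ θ(w)aδ_{u(w)T̃})) = Σ_w θ(w)a · ({∞, (δ⁻¹t_wδ)∞} ⊗ 1)`. [cite: AshStevens1986, §1 (1.3); Brown1982, Ch. III §9] -/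
theorem torusInvariantsToCuspidal_cosetClass_twistFamilyCycle (γ : torusLevel p M) (a : k) :
    torusInvariantsToCuspidal k p M hpM (cosetClass k p M (twistFamilyCycle k p M θ hθ γ a)) =
      ∑ w : ZMod p, (MulChar.ofUnitHom θ w * a) • Literature.NumberTheory.ModularSymbols.symbol (p ^ 2 * M) k
        (torusLevelEquiv p M hpM (twistTransfer p M hpM γ w) : Gamma0 (p ^ 2 * M)) := by
  rw [cosetClass_twistFamilyCycle_eq]
  exact torusInvariantsToCuspidal_cosetClass_family k p M (twistSection p M hpM) (twistSection_smul p M hpM) hpM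
    (fun _ : ZMod p => γ.1) (unipCoset p) (fun w => MulChar.ofUnitHom θ w * a) _

omit [Fintype (diagTorus (ZMod p))] [Invertible (Fintype.card (diagTorus (ZMod p)) : k)] [NeZero M] [NeZero (p ^ 2 * M)] in
include hθχ in
/-- `θ(−1)·θ(w) = χ(−w)` in `k` under the dictionary hypothesis. [cite: Stevens1989, (5.5) p. 97] -/
theorem ofUnitHom_neg_one_mul_eq_quadInt_neg (w : ZMod p) :
    MulChar.ofUnitHom θ (-1 : ZMod p) * MulChar.ofUnitHom θ w = (quadInt χ (-w) : k) := by
  rw [← hθχ, ofUnitHom_neg k p θ w]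

include hθχ hprim in
/-- **Twist comparison on base coset classes**: for `γ ∈ Γ_T`,
`(dictionary ∘ M_θT_θ^{up})(cosetClass[γ ⊗ aδ_{T̃}]) = T_χ^{down}(dictionary(cosetClass[γ ⊗ aδ_{T̃}]))`.
[cite: MazurTateTeitelbaum1986, §I.8; Stevens1989, Lemma (5.4) p. 97] -/
theorem twistComparison_baseCycle (γ : torusLevel p M) (a : k) :
    torusInvariantsToCuspidal k p M hpM (twistInvariants k p M θ hθ (cosetClass k p M (baseCycle k p M γ a))) =
      twistDownK (p ^ 2 * M) (dvd_mul_right (p ^ 2) M) hχ hprim k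
        (torusInvariantsToCuspidal k p M hpM (cosetClass k p M (baseCycle k p M γ a))) := by
  rw [twistInvariants_cosetClass_baseCycle_eq, map_smul, torusInvariantsToCuspidal_cosetClass_twistFamilyCycle,
    torusInvariantsToCuspidal_cosetClass_baseCycle, map_smul]
  by_cases hc0 : ((γ.1 : SL(2, ℤ)) : Matrix (Fin 2) (Fin 2) ℤ) 1 0 = 0
  · -- both sides vanish: every matrix involved has lower-left entry `pc = 0`
    have hγ' : ((torusLevelEquiv p M hpM γ : Gamma0 (p ^ 2 * M)) : SL(2, ℤ)) 1 0 = 0 := by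
      show (((torusLevelEquiv p M hpM γ : Gamma0 (p ^ 2 * M)) : SL(2, ℤ)) : Matrix (Fin 2) (Fin 2) ℤ) 1 0 = 0
      rw [(entry_torusLevelEquiv p M hpM γ).1, hc0, zero_mul]
    have hX : ∀ w : ZMod p, ((torusLevelEquiv p M hpM (twistTransfer p M hpM γ w) : Gamma0 (p ^ 2 * M)) : SL(2, ℤ)) 1 0 = 0 :=
      fun w => by
        show (((torusLevelEquiv p M hpM (twistTransfer p M hpM γ w) : Gamma0 (p ^ 2 * M)) : SL(2, ℤ)) :
          Matrix (Fin 2) (Fin 2) ℤ) 1 0 = 0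
        rw [(entry_torusLevelEquiv_twistTransfer p M hpM γ w).1, hc0, zero_mul]
    rw [twistDownK_symbol_of_entry_eq_zero _ _ hχ hprim k _ hγ', smul_zero]
    rw [Finset.sum_eq_zero (fun w _ => by rw [symbol_eq_zero_of_entry_eq_zero k _ (hX w), smul_zero]), smul_zero]
  · have hp0 : (p : ℤ) ≠ 0 := by exact_mod_cast (Fact.out : p.Prime).ne_zero
    have hγ' : ((torusLevelEquiv p M hpM γ : Gamma0 (p ^ 2 * M)) : SL(2, ℤ)) 1 0 ≠ 0 := by
      show (((torusLevelEquiv p M hpM γ : Gamma0 (p ^ 2 * M)) : SL(2, ℤ)) : Matrix (Fin 2) (Fin 2) ℤ) 1 0 ≠ 0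
      rw [(entry_torusLevelEquiv p M hpM γ).1]
      exact mul_ne_zero hc0 hp0
    -- the matrices `X_u := δ⁻¹ t_{−u} δ` have cusps `γ'∞ + u/p (mod ℤ)`
    have hX : ∀ u : ZMod p, ((torusLevelEquiv p M hpM (twistTransfer p M hpM γ (-u)) : Gamma0 (p ^ 2 * M)) : SL(2, ℤ)) 1 0 ≠ 0 :=
      fun u => by
        show (((torusLevelEquiv p M hpM (twistTransfer p M hpM γ (-u)) : Gamma0 (p ^ 2 * M)) : SL(2, ℤ)) :
          Matrix (Fin 2) (Fin 2) ℤ) 1 0 ≠ 0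
        rw [(entry_torusLevelEquiv_twistTransfer p M hpM γ (-u)).1]
        exact mul_ne_zero hc0 hp0
    have hcusp : ∀ u : ZMod p, ∃ n : ℤ,
        ((((torusLevelEquiv p M hpM (twistTransfer p M hpM γ (-u)) : Gamma0 (p ^ 2 * M)) : SL(2, ℤ)) 0 0 : ℤ) : ℚ) /
          ((((torusLevelEquiv p M hpM (twistTransfer p M hpM γ (-u)) : Gamma0 (p ^ 2 * M)) : SL(2, ℤ)) 1 0 : ℤ) : ℚ) =
        ((((torusLevelEquiv p M hpM γ : Gamma0 (p ^ 2 * M)) : SL(2, ℤ)) 0 0 : ℤ) : ℚ) /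
          ((((torusLevelEquiv p M hpM γ : Gamma0 (p ^ 2 * M)) : SL(2, ℤ)) 1 0 : ℤ) : ℚ) + twistShift u + n := fun u => by
      obtain ⟨n, hn⟩ := exists_neg_val_div_eq_twistShift_neg p (-u)
      refine ⟨n, ?_⟩
      obtain ⟨h10, h00⟩ := entry_torusLevelEquiv_twistTransfer p M hpM γ (-u)
      obtain ⟨g10, g00⟩ := entry_torusLevelEquiv p M hpM γ
      rw [neg_neg] at hn
      rw [show ((((torusLevelEquiv p M hpM (twistTransfer p M hpM γ (-u)) : Gamma0 (p ^ 2 * M)) : SL(2, ℤ)) 0 0 : ℤ) : ℚ)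
          = (((γ.1 : SL(2, ℤ)) : Matrix (Fin 2) (Fin 2) ℤ) 0 0 : ℚ) -
            (((-u).val : ℤ) : ℚ) * (((γ.1 : SL(2, ℤ)) : Matrix (Fin 2) (Fin 2) ℤ) 1 0 : ℚ) from by
          rw [show (((torusLevelEquiv p M hpM (twistTransfer p M hpM γ (-u)) : Gamma0 (p ^ 2 * M)) : SL(2, ℤ)) 0 0 : ℤ) =
            _ from h00]; push_cast; ring,
        show ((((torusLevelEquiv p M hpM (twistTransfer p M hpM γ (-u)) : Gamma0 (p ^ 2 * M)) : SL(2, ℤ)) 1 0 : ℤ) : ℚ)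
          = (((γ.1 : SL(2, ℤ)) : Matrix (Fin 2) (Fin 2) ℤ) 1 0 : ℚ) * p from by
          rw [show (((torusLevelEquiv p M hpM (twistTransfer p M hpM γ (-u)) : Gamma0 (p ^ 2 * M)) : SL(2, ℤ)) 1 0 : ℤ) =
            _ from h10]; push_cast; ring,
        show ((((torusLevelEquiv p M hpM γ : Gamma0 (p ^ 2 * M)) : SL(2, ℤ)) 0 0 : ℤ) : ℚ) =
          (((γ.1 : SL(2, ℤ)) : Matrix (Fin 2) (Fin 2) ℤ) 0 0 : ℚ) from by
          rw [show (((torusLevelEquiv p M hpM γ : Gamma0 (p ^ 2 * M)) : SL(2, ℤ)) 0 0 : ℤ) = _ from g00],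
        show ((((torusLevelEquiv p M hpM γ : Gamma0 (p ^ 2 * M)) : SL(2, ℤ)) 1 0 : ℤ) : ℚ) =
          (((γ.1 : SL(2, ℤ)) : Matrix (Fin 2) (Fin 2) ℤ) 1 0 : ℚ) * p from by
          rw [show (((torusLevelEquiv p M hpM γ : Gamma0 (p ^ 2 * M)) : SL(2, ℤ)) 1 0 : ℤ) = _ from g10]; push_cast; ring]
      have hc0' : (((γ.1 : SL(2, ℤ)) : Matrix (Fin 2) (Fin 2) ℤ) 1 0 : ℚ) ≠ 0 := by exact_mod_cast hc0
      have hp0' : (p : ℚ) ≠ 0 := by exact_mod_cast (Fact.out : p.Prime).ne_zero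
      rw [add_assoc, ← hn, Int.cast_natCast]
      field_simp
      ring
    rw [twistDownK_symbol_eq_sum _ _ hχ hprim k _ hγ' _ hX hcusp, Finset.smul_sum, Finset.smul_sum]
    -- reindex `u ↦ −u` and compare coefficients
    refine Fintype.sum_equiv (Equiv.neg (ZMod p)) _ _ fun w => ?_
    rw [Equiv.neg_apply, neg_neg, smul_smul, smul_smul, ← mul_assoc, ofUnitHom_neg_one_mul_eq_quadInt_neg p k θ hθχ w,
      mul_comm a]

include hθχ hprim in
/-- **TWIST COMPATIBILITY OF THE UP/DOWN DICTIONARY.**  For `gcd(p, M) = 1`, `|T̃| ∈ kˣ`, `θ` involutive with `θ = χ` in `k`: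
`torusInvariantsToCuspidal ∘ (M_θ T_θ^{up}) = T_χ^{down} ∘ torusInvariantsToCuspidal` on `H₁(Γ₀(M), k[GL₂(ℤ/p)])^{T̃}`, where
`T_χ^{down} = twistDownK (p²M)` is the twisting operator `Σ_u χ(u)[1 u/p; 0 1]_*` of `H(p²M; k) = H₁(X₀(p²M), k)`.
[cite: MazurTateTeitelbaum1986, §I.8; Stevens1989, Lemma (5.4) p. 97; AshStevens1986, §1 (1.2)–(1.4)] -/
theorem twistComparison (y : PermutationCoeff.H1Invariants k (redGL p M) (diagTorus (ZMod p))) :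
    torusInvariantsToCuspidal k p M hpM (twistInvariants k p M θ hθ y) =
      twistDownK (p ^ 2 * M) (dvd_mul_right (p ^ 2) M) hχ hprim k (torusInvariantsToCuspidal k p M hpM y) := by
  obtain ⟨w, rfl⟩ : ∃ w, (torusInvariantsEquiv k p M hpM).symm w = y :=
    ⟨torusInvariantsEquiv k p M hpM y, LinearEquiv.symm_apply_apply _ _⟩
  induction w using H1_induction_on with
  | h x =>
    have hx : x = (cycles₁IsoOfIsTrivial (Rep.trivial k (torusLevel p M) k)).inv x.1 :=
      Subtype.ext (cycles₁IsoOfIsTrivial_inv_apply _).symm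
    rw [hx]
    generalize x.1 = f
    induction f using Finsupp.induction_linear with
    | zero => simp
    | add f₁ f₂ h₁ h₂ => simp only [map_add, h₁, h₂]
    | single γ a =>
      rw [torusInvariantsEquiv_symm_single]
      exact twistComparison_baseCycle p M hpM k θ hθ hχ hprim hθχ γ a

include hθχ hprim in
/-- **The transfer identity on period classes**: for a cusp form `f` of level `p²M`,
`torusPeriodClass f (M_θ T_θ^{up} y) = (1 ⊗ g(χ)·)(torusPeriodClass f_χ y)` in `k ⊗ Λ_f` (`f_χ = charTwist … f`), for every
`y ∈ H₁(Γ₀(M), k[GL₂(ℤ/p)])^{T̃}`.  This is «`βW ∘ (g(χ)·) = T_χ ∘ βV`» of the K-line datum read on the carrier.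
[cite: Stevens1989, Lemma (5.4) p. 97; MazurTateTeitelbaum1986, §I.8] -/
theorem torusPeriodClass_twistInvariants (f : CuspForm (Gamma0 (p ^ 2 * M)) 2)
    (y : PermutationCoeff.H1Invariants k (redGL p M) (diagTorus (ZMod p))) :
    torusPeriodClass k p M hpM f (twistInvariants k p M θ hθ y) =
      (gaussMulLattice (p ^ 2 * M) (dvd_mul_right (p ^ 2) M) hχ hprim f).baseChange k
        (torusPeriodClass k p M hpM (charTwist (p ^ 2 * M) dvd_rfl (dvd_mul_right (p ^ 2) M) hχ f) y) := by
  rw [torusPeriodClass, LinearMap.comp_apply, twistComparison p M hpM k θ hθ hχ hprim hθχ y, periodClassK_twistDownK]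
  rfl

end FullLevel

end Literature.NumberTheory.ModularSymbols
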